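/-
Copyright (c) 2026. All rights reserved.
Released under Apache 2.0 license as described in the file LICENSE.
-/
import Literature.NumberTheory.Automorphic.BrandtSetupAtkinLehnerInvolutions
import HarnessLib

/-!
# The Atkin–Lehner involutions commute with the Brandt matrices: `T(n)_{W c, W c'} = T(n)_{c c'}` for `W = W_{q⁻}` and
# `W = W_{p⁺}` on the class set of every Brandt setup, and `T(n) T(q) = T(q) T(n)` for all `n` at a ramified `q`
# (Vignéras III §5 exercice 5.8 (d); Voight 41.3.4–(41.3.5))

[tag: quaternion_algebra] [tag: eichler_order] [tag: hecke_operator]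

Topic `NumberTheory/Automorphic`; THEOREMS ONLY (no definition, no named fact, no instance; net Literature debt `0`).
Lane `lit-hodgefound`, seat p12, gen 51 — sequel of `BrandtSetupAtkinLehnerInvolutions.lean` (the involutions
`W_{q⁻} = XiSetup.wMinus`, `[I] ↦ [I 𝔓_q]`, and `W_{p⁺} = XiSetup.wPlus`, `[I] ↦ [I 𝔔_{p^e}]`, of `Cls O`).

THE PRINTED STATEMENTS. Vignéras, LNM 800, Ch. III §5 exercice 5.8 (d): «Les matrices de Brandt et les matrices de permutation
engendrent une `R`-algèbre commutative»; Voight, *Quaternion Algebras*, 41.3.4–(41.3.5): for the permutation matrices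
`P(𝔞)` of `I_i ↦ 𝔞 I_i`, «for all `𝔞, 𝔫` we have `P(𝔞) T(𝔫) = T(𝔫) P(𝔞)` by commutativity of multiplication by `𝔞`».
Here the two-sided ideal is `𝔗 = 𝔓_q` or `𝔔_{p^e}` (not central, but invertible with `I 𝔗 𝔗 = m I`), and the proof is the
bijection `J ↦ J 𝔗` between the right ideals `J ⊆ I_{c'}` of index `n²` in the class `c` and the right ideals
`J' ⊆ I_{c'} 𝔗` of index `n²` in the class `W c` — it needs exactly one arithmetic input, the constancy of the index
`[I : I 𝔗]` over the invertible right ideals `I` (`= q²` for `𝔓_q`, `BrandtMatrixRamified.lean`; `= [O : 𝔔]` for `𝔔`, proved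
here prime by prime), which makes `J ↦ J 𝔗` index-preserving.

* §1 indices: `XiSetup.relIndex_mul_eq_of_const` (`[I 𝔗 : J 𝔗] = [I : J]` from the constancy of `[I : I 𝔗]`),
  `XiSetup.relIndex_mul_normPrimeIdeal_of_dvd` (`[I : I 𝔓_q] = q²`), **`XiSetup.relIndex_mul_atkinLehnerIdeal_eq`**
  (`[I : I 𝔔_{p^e}] = [O : 𝔔_{p^e}]`, local indices: `(I 𝔔)₍p₎ = β w O₍p₎`, `(I 𝔔)₍r₎ = I₍r₎` for `r ≠ p`).
* §2 the bijection `J ↦ J 𝔗` (`XiSetup.brandtSet_mul_right_eq_image`, `XiSetup.ncard_brandtSet_mul_right`) and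
  **`XiSetup.matrix_apply_mk_rep_mul`**: `T(n)_{[I_c 𝔗],[I_{c'} 𝔗]} = T(n)_{c c'}` for every `n`.
* §3 **`XiSetup.matrix_apply_wMinus_wMinus`** and **`XiSetup.matrix_apply_wPlus_wPlus`** (`T(n)_{W c, W c'} = T(n)_{c c'}`
  for all `n`, both kinds), the one-sided forms `T(n)_{c, W c'} = T(n)_{W c, c'}`, and the equivariance of the Hecke action
  on `ℤ^{Cls O}`: **`T(n) (v ∘ W) = (T(n) v) ∘ W`** (`XiSetup.mulVec_comp_wMinus`, `XiSetup.mulVec_comp_wPlus`).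
* §4 **`T(n) T(q) = T(q) T(n)` for EVERY `n` and every ramified `q ∣ N⁻`** (`XiSetup.matrix_mul_matrix_ramified_comm_of_dvd`;
  the tree's `XiSetup.matrix_comm_of_coprime_level` needed `n` prime to `N⁺`), with the entries
  `(T(n) T(q))_{c c'} = T(n)_{c, W_{q⁻} c'}`, `(T(q) T(n))_{c c'} = T(n)_{W_{q⁻} c, c'}`.

## References

* [VignerasLNM800] M.-F. Vignéras, *Arithmétique des algèbres de quaternions*, LNM 800 (1980), Ch. III §5 exercice 5.8
  (b)–(d) (p. 87 of the held copy); Ch. II §1 Cor. 1.7, §2.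
* [Voight2021] J. Voight, *Quaternion Algebras*, GTM 288: Prop. 41.3.1, 41.3.4–(41.3.5), Lemma 26.3.6 (unique factorisation
  of compatible products).
* [BertoliniDarmon1996] M. Bertolini, H. Darmon, Invent. Math. 126 (1996), §1.5 (`W_{l⁺}`, `W_{l⁻}` commute with the Hecke
  correspondences).
-/

noncomputable section

open scoped Pointwise Matrix

universe u

namespace Literature.NumberTheory.Automorphic

namespace Brandt

variable {Nplus Nminus : ℕ} (S : XiSetup Nplus Nminus)

/-- The algebra of a setup is a division algebra. [folklore] -/
private theorem XiSetup.hdivD'' : ∀ x : S.D, x ≠ 0 → IsUnit x :=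
  fun _ hx => isUnit_of_isTotallyDefinite S.D S.isTotallyDefinite hx

/-- `J O = J` for a right `O`-ideal `J`. [folklore] -/
private theorem XiSetup.mul_order_eq {J : Submodule ℤ S.D} (hJ : J ∈ rightIdeals S.O) : J * S.O = J := by
  have := mul_rightOrder_self J
  rwa [hJ.2.1] at this

/-- A central unit `ν = m · 1` acts as the integer `m`: `ν J = m J`. [folklore] -/
private theorem units_smul_eq_natCast_smul'' {D : Type u} [Ring D] {ν : Dˣ} {m : ℕ} (hν : (ν : D) = (m : ℤ))
    (J : Submodule ℤ D) : ν • J = (m : ℤ) • J := by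
  ext x
  constructor
  · intro hx
    obtain ⟨y, hy, rfl⟩ := exists_eq_zsmul_of_mem_units_smul hν hx
    exact Submodule.smul_mem_pointwise_smul y _ J hy
  · intro hx
    obtain ⟨y, hy, rfl⟩ := (Submodule.mem_smul_pointwise_iff_exists x _ J).mp hx
    exact units_smul_eq_zsmul_of_val_eq hν J hy

/-! ## §1 Indices: `[I 𝔗 : J 𝔗] = [I : J]` -/

/-- **`[I 𝔗 : J 𝔗] = [I : J]` for right ideals `J ⊆ I` as soon as `[K : K 𝔗]` is the same non-zero number for all right
ideals `K`** (`𝔗 ⊆ O`): both sides of `[I : J 𝔗] = [I : J][J : J 𝔗] = [I : I 𝔗][I 𝔗 : J 𝔗]`. [cite: Voight2021, Lemma 26.3.6 and 41.3.4] -/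
theorem XiSetup.relIndex_mul_eq_of_const {T : Submodule ℤ S.D} (hTO : T ≤ S.O) {N : ℕ} (hN : N ≠ 0)
    (hidx : ∀ K ∈ rightIdeals S.O, (K * T).toAddSubgroup.relIndex K.toAddSubgroup = N)
    {I J : Submodule ℤ S.D} (hI : I ∈ rightIdeals S.O) (hJ : J ∈ rightIdeals S.O) (hJI : J ≤ I) :
    (J * T).toAddSubgroup.relIndex (I * T).toAddSubgroup = J.toAddSubgroup.relIndex I.toAddSubgroup := by
  have hJT : J * T ≤ J := (mul_le_mul' le_rfl hTO).trans (S.mul_order_eq hJ).le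
  have hIT : I * T ≤ I := (mul_le_mul' le_rfl hTO).trans (S.mul_order_eq hI).le
  have hJTIT : J * T ≤ I * T := mul_le_mul' hJI le_rfl
  have h1 := AddSubgroup.relIndex_mul_relIndex _ _ _ (Submodule.toAddSubgroup_mono hJT) (Submodule.toAddSubgroup_mono hJI)
  have h2 := AddSubgroup.relIndex_mul_relIndex _ _ _ (Submodule.toAddSubgroup_mono hJTIT) (Submodule.toAddSubgroup_mono hIT)
  rw [hidx J hJ] at h1
  rw [hidx I hI, ← h1, mul_comm N] at h2
  exact mul_right_cancel₀ hN h2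

/-- **`[I : I 𝔓_q] = q²`** for every right `O`-ideal `I` of a Brandt setup and every `q ∣ N⁻`. [cite: VignerasLNM800, Ch. II §1 Cor. 1.7] -/
theorem XiSetup.relIndex_mul_normPrimeIdeal_of_dvd {q : ℕ} [Fact q.Prime] (hq : q ∣ Nminus) {I : Submodule ℤ S.D}
    (hI : I ∈ rightIdeals S.O) : (I * normPrimeIdeal S.O q).toAddSubgroup.relIndex I.toAddSubgroup = q ^ 2 :=
  relIndex_mul_normPrimeIdeal (S.hdiv_of_dvd hq) (S.maximalAt_of_dvd hq) S.isZOrder_O (S.isInvertibleRightIdeal_of_mem hI)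

/-- `𝔔_m` is a right `O`-ideal of the setup (`𝔔 = O 𝔔`). [cite: VignerasLNM800, Ch. II §2 (normalisateur)] -/
theorem XiSetup.atkinLehnerIdeal_mem_rightIdeals {p : ℕ} [Fact p.Prime] (hp : ¬ p ∣ Nminus) :
    atkinLehnerIdeal S.O (p ^ Nplus.factorization p) ∈ rightIdeals S.O := by
  have h := S.mul_atkinLehnerIdeal_mem hp S.self_mem_rightIdeals
  rwa [order_mul_atkinLehnerIdeal S.isZOrder_O] at h

/-- **`[I : I 𝔔_{p^e}] = [O : 𝔔_{p^e}]`** (`e = v_p(N⁺)`) for every right `O`-ideal `I`: both indices are `p`-powers with the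
same local index at `p` (`(I 𝔔)₍p₎ = β w O₍p₎` where `I₍p₎ = β O₍p₎` and `𝔔₍p₎ = w O₍p₎`) and local index `1` elsewhere.
[cite: VignerasLNM800, Ch. II §2 (normalisateur) and Ch. III §5 Prop. 5.1] [cite: Voight2021, 41.3.4] -/
theorem XiSetup.relIndex_mul_atkinLehnerIdeal_eq {p : ℕ} [hpf : Fact p.Prime] (hp : ¬ p ∣ Nminus) {I : Submodule ℤ S.D}
    (hI : I ∈ rightIdeals S.O) :
    (I * atkinLehnerIdeal S.O (p ^ Nplus.factorization p)).toAddSubgroup.relIndex I.toAddSubgroup =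
      (atkinLehnerIdeal S.O (p ^ Nplus.factorization p)).toAddSubgroup.relIndex S.O.toAddSubgroup := by
  haveI : IsAddTorsionFree S.D := S.isAddTorsionFree
  have hO := S.isZOrder_O
  have hm : p ^ Nplus.factorization p ≠ 0 := pow_ne_zero _ hpf.out.ne_zero
  have hIinv := S.isInvertibleRightIdeal_of_mem hI
  set Q := atkinLehnerIdeal S.O (p ^ Nplus.factorization p) with hQ
  have hIQ : I * Q ∈ rightIdeals S.O := S.mul_atkinLehnerIdeal_mem hp hI
  have hQmem : Q ∈ rightIdeals S.O := S.atkinLehnerIdeal_mem_rightIdeals hp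
  have hn1 : (I * Q).toAddSubgroup.relIndex I.toAddSubgroup ≠ 0 := relIndex_ne_zero_of_isFullLattice hIQ.1 hI.1.1
  have hn2 : Q.toAddSubgroup.relIndex S.O.toAddSubgroup ≠ 0 :=
    relIndex_ne_zero_of_isFullLattice hQmem.1 hO.isFullLattice.1
  obtain ⟨Φ, hΦ⟩ := S.exists_isLevelShape_iff S.nplus_ne_zero hp
  obtain ⟨w, hw, hW, hdet⟩ := exists_atkinLehner_generator Φ hO hΦ S.hdivD''
  refine Nat.eq_of_factorization_eq hn1 hn2 fun r => ?_
  by_cases hr : r.Prime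
  · haveI : Fact r.Prime := ⟨hr⟩
    have e1 := relIndex_localAt (p := r) I (I * Q) (mul_atkinLehnerIdeal_le hIinv) hn1
    have e2 := relIndex_localAt (p := r) S.O Q (atkinLehnerIdeal_le _ _) hn2
    have hloc : (localAt r (I * Q)).toAddSubgroup.relIndex (localAt r I).toAddSubgroup =
        (localAt r Q).toAddSubgroup.relIndex (localAt r S.O).toAddSubgroup := by
      by_cases hrp : r = p
      · subst hrp
        obtain ⟨β, -, hβ⟩ := hIinv.exists_localAt_eq_units_smul S.hdivD'' hO r
        rw [localAt_mul_atkinLehnerIdeal_self Φ hO hΦ hβ hw hW hdet, hβ,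
          localAt_atkinLehnerIdeal_eq_units_smul Φ hO hΦ hw hW hdet, mul_smul, relIndex_units_smul]
      · have hcop : (p ^ Nplus.factorization p).Coprime r :=
          Nat.Coprime.pow_left _ ((Nat.coprime_primes hpf.out hr).mpr (Ne.symm hrp))
        rw [localAt_mul_atkinLehnerIdeal_of_coprime hO hm hIinv hcop, localAt_atkinLehnerIdeal_of_coprime hO hm hcop,
          AddSubgroup.relIndex_self, AddSubgroup.relIndex_self]
    rw [hloc, e2] at e1
    exact Nat.pow_right_injective hr.two_le e1.symm
  · rw [Nat.factorization_eq_zero_of_not_prime _ hr, Nat.factorization_eq_zero_of_not_prime _ hr]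

/-- `[O : 𝔔_{p^e}] ≠ 0`. [cite: VignerasLNM800, Ch. II §2] -/
theorem XiSetup.relIndex_atkinLehnerIdeal_ne_zero {p : ℕ} [Fact p.Prime] (hp : ¬ p ∣ Nminus) :
    (atkinLehnerIdeal S.O (p ^ Nplus.factorization p)).toAddSubgroup.relIndex S.O.toAddSubgroup ≠ 0 :=
  haveI : IsAddTorsionFree S.D := S.isAddTorsionFree
  relIndex_ne_zero_of_isFullLattice (S.atkinLehnerIdeal_mem_rightIdeals hp).1 S.isZOrder_O.isFullLattice.1

/-- **`[I 𝔓_q : J 𝔓_q] = [I : J]`** for right ideals `J ⊆ I` and `q ∣ N⁻`. [cite: VignerasLNM800, Ch. II §1 Cor. 1.7 and Ch. III §5 exercice 5.8 (c)] -/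
theorem XiSetup.relIndex_mul_normPrimeIdeal_eq_relIndex {q : ℕ} [hqf : Fact q.Prime] (hq : q ∣ Nminus)
    {I J : Submodule ℤ S.D} (hI : I ∈ rightIdeals S.O) (hJ : J ∈ rightIdeals S.O) (hJI : J ≤ I) :
    (J * normPrimeIdeal S.O q).toAddSubgroup.relIndex (I * normPrimeIdeal S.O q).toAddSubgroup =
      J.toAddSubgroup.relIndex I.toAddSubgroup :=
  S.relIndex_mul_eq_of_const (normPrimeIdeal_le S.O q) (pow_ne_zero 2 hqf.out.ne_zero)
    (fun _ hK => S.relIndex_mul_normPrimeIdeal_of_dvd hq hK) hI hJ hJI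

/-- **`[I 𝔔 : J 𝔔] = [I : J]`** for right ideals `J ⊆ I` and `𝔔 = 𝔔_{p^{v_p(N⁺)}}`, `p ∤ N⁻`. [cite: VignerasLNM800, Ch. II §2 and Ch. III §5] [cite: Voight2021, 41.3.4] -/
theorem XiSetup.relIndex_mul_atkinLehnerIdeal_eq_relIndex {p : ℕ} [Fact p.Prime] (hp : ¬ p ∣ Nminus)
    {I J : Submodule ℤ S.D} (hI : I ∈ rightIdeals S.O) (hJ : J ∈ rightIdeals S.O) (hJI : J ≤ I) :
    (J * atkinLehnerIdeal S.O (p ^ Nplus.factorization p)).toAddSubgroup.relIndex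
        (I * atkinLehnerIdeal S.O (p ^ Nplus.factorization p)).toAddSubgroup =
      J.toAddSubgroup.relIndex I.toAddSubgroup :=
  S.relIndex_mul_eq_of_const (atkinLehnerIdeal_le S.O _) (S.relIndex_atkinLehnerIdeal_ne_zero hp)
    (fun _ hK => S.relIndex_mul_atkinLehnerIdeal_eq hp hK) hI hJ hJI

/-! ## §2 The bijection `J ↦ J 𝔗` on the sets counted by the Brandt matrices -/

section Bijection

variable {T : Submodule ℤ S.D} (hT : ∀ I ∈ rightIdeals S.O, I * T ∈ rightIdeals S.O) {m : ℕ} (hm : m ≠ 0)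
  (hTT : ∀ I ∈ rightIdeals S.O, I * T * T = (m : ℤ) • I)
  (hidx : ∀ I ∈ rightIdeals S.O, ∀ J ∈ rightIdeals S.O, J ≤ I →
    (J * T).toAddSubgroup.relIndex (I * T).toAddSubgroup = J.toAddSubgroup.relIndex I.toAddSubgroup)
include hT hm hTT hidx

/-- `J ↦ J 𝔗` is injective on right ideals (`J 𝔗 𝔗 = m J`). [cite: Voight2021, Lemma 26.3.6] -/
theorem XiSetup.mul_right_injOn_rightIdeals {J₁ J₂ : Submodule ℤ S.D} (h₁ : J₁ ∈ rightIdeals S.O) (h₂ : J₂ ∈ rightIdeals S.O)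
    (h : J₁ * T = J₂ * T) : J₁ = J₂ := by
  have _ := hidx
  have _ := hT
  obtain ⟨ν, hν, -⟩ := exists_units_val_eq_natCast (D := S.D) hm
  have e : (m : ℤ) • J₁ = (m : ℤ) • J₂ := by rw [← hTT J₁ h₁, ← hTT J₂ h₂, h]
  rw [← units_smul_eq_natCast_smul'' hν, ← units_smul_eq_natCast_smul'' hν] at e
  have := congrArg (fun L : Submodule ℤ S.D => ν⁻¹ • L) e
  simpa only [inv_smul_smul] using this

/-- `J 𝔗 ⊆ I 𝔗 ⟹ J ⊆ I` for right ideals (multiply by `𝔗` once more: `m J ⊆ m I`). [cite: Voight2021, Lemma 26.3.6] -/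
theorem XiSetup.le_of_mul_right_le {I J : Submodule ℤ S.D} (hI : I ∈ rightIdeals S.O) (hJ : J ∈ rightIdeals S.O)
    (h : J * T ≤ I * T) : J ≤ I := by
  have _ := hidx
  have _ := hT
  obtain ⟨ν, hν, -⟩ := exists_units_val_eq_natCast (D := S.D) hm
  have e : (m : ℤ) • J ≤ (m : ℤ) • I := by
    rw [← hTT J hJ, ← hTT I hI]
    exact mul_le_mul' h le_rfl
  rw [← units_smul_eq_natCast_smul'' hν, ← units_smul_eq_natCast_smul'' hν] at e
  exact (units_smul_le_units_smul_iff ν).mp e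

/-- **The set counted by `T(n)_{[I' 𝔗],[I 𝔗]}` is the image under `J ↦ J 𝔗` of the set counted by `T(n)_{[I'],[I]}`.**
[cite: Voight2021, 41.3.4–(41.3.5)] [cite: VignerasLNM800, Ch. III §5 exercice 5.8 (d)] -/
theorem XiSetup.brandtSet_mul_right_eq_image (n : ℕ) {I' I : Submodule ℤ S.D} (hI' : I' ∈ rightIdeals S.O)
    (hI : I ∈ rightIdeals S.O) :
    {J : Submodule ℤ S.D | J ≤ I * T ∧ J.toAddSubgroup.relIndex (I * T).toAddSubgroup = n ^ 2 ∧
        ∃ α : S.Dˣ, J = α • (I' * T)} =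
      (fun J : Submodule ℤ S.D => J * T) ''
        {J : Submodule ℤ S.D | J ≤ I ∧ J.toAddSubgroup.relIndex I.toAddSubgroup = n ^ 2 ∧ ∃ α : S.Dˣ, J = α • I'} := by
  have hord : IsOrder S.D S.O := S.isEichlerOrder.isOrder
  ext J'
  simp only [Set.mem_setOf_eq, Set.mem_image]
  constructor
  · rintro ⟨hle, hidx', α, hα⟩
    have hαI' : α • I' ∈ rightIdeals S.O := units_smul_mem_rightIdeals_of_isTotallyDefinite S.isTotallyDefinite hord hI' α
    have hJ' : J' = (α • I') * T := by rw [hα, smul_mul_assoc]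
    refine ⟨α • I', ⟨?_, ?_, α, rfl⟩, hJ'.symm⟩
    · exact S.le_of_mul_right_le hT hm hTT hidx hI hαI' (hJ' ▸ hle)
    · have hJI : α • I' ≤ I := S.le_of_mul_right_le hT hm hTT hidx hI hαI' (hJ' ▸ hle)
      rw [← hidx I hI _ hαI' hJI, ← hJ']
      exact hidx'
  · rintro ⟨J, ⟨hle, hidx', α, hα⟩, rfl⟩
    have hJ : J ∈ rightIdeals S.O := hα ▸ units_smul_mem_rightIdeals_of_isTotallyDefinite S.isTotallyDefinite hord hI' α
    refine ⟨mul_le_mul' hle le_rfl, ?_, α, by rw [hα, smul_mul_assoc]⟩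
    rw [hidx I hI J hJ hle]
    exact hidx'

/-- **`#{J ⊆ I 𝔗 : [I 𝔗 : J] = n², J ∼ I' 𝔗} = #{J ⊆ I : [I : J] = n², J ∼ I'}`** (the bijection `J ↦ J 𝔗`). [cite: Voight2021, 41.3.4–(41.3.5)] -/
theorem XiSetup.ncard_brandtSet_mul_right (n : ℕ) {I' I : Submodule ℤ S.D} (hI' : I' ∈ rightIdeals S.O)
    (hI : I ∈ rightIdeals S.O) :
    {J : Submodule ℤ S.D | J ≤ I * T ∧ J.toAddSubgroup.relIndex (I * T).toAddSubgroup = n ^ 2 ∧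
        ∃ α : S.Dˣ, J = α • (I' * T)}.ncard =
      {J : Submodule ℤ S.D | J ≤ I ∧ J.toAddSubgroup.relIndex I.toAddSubgroup = n ^ 2 ∧ ∃ α : S.Dˣ, J = α • I'}.ncard := by
  have hord : IsOrder S.D S.O := S.isEichlerOrder.isOrder
  rw [S.brandtSet_mul_right_eq_image hT hm hTT hidx n hI' hI]
  refine Set.InjOn.ncard_image fun J₁ h₁ J₂ h₂ h => ?_
  obtain ⟨-, -, α₁, hα₁⟩ := h₁
  obtain ⟨-, -, α₂, hα₂⟩ := h₂
  exact S.mul_right_injOn_rightIdeals hT hm hTT hidx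
    (hα₁ ▸ units_smul_mem_rightIdeals_of_isTotallyDefinite S.isTotallyDefinite hord hI' α₁)
    (hα₂ ▸ units_smul_mem_rightIdeals_of_isTotallyDefinite S.isTotallyDefinite hord hI' α₂) h

/-- **`T(n)_{[I_c 𝔗],[I_{c'} 𝔗]} = T(n)_{c c'}` for every `n`**: right multiplication by an invertible two-sided ideal with
`I 𝔗 𝔗 = m I` and constant index `[I : I 𝔗]` commutes with every Brandt matrix. [cite: Voight2021, (41.3.5)] [cite: VignerasLNM800, Ch. III §5 exercice 5.8 (d)] -/
theorem XiSetup.matrix_apply_mk_rep_mul (n : ℕ) (c c' : ClassSet S.O) :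
    matrix S.O n (Quotient.mk (rightClassSetoid S.O) ⟨c.rep * T, hT _ c.rep_mem⟩)
        (Quotient.mk (rightClassSetoid S.O) ⟨c'.rep * T, hT _ c'.rep_mem⟩) = matrix S.O n c c' := by
  rw [matrix_apply_eq_ncard S.O n ⟨c.rep * T, hT _ c.rep_mem⟩ ⟨c'.rep * T, hT _ c'.rep_mem⟩]
  conv_rhs => rw [← ClassSet.mk_rep c, ← ClassSet.mk_rep c',
    matrix_apply_eq_ncard S.O n ⟨c.rep, c.rep_mem⟩ ⟨c'.rep, c'.rep_mem⟩]
  exact congrArg Nat.cast (S.ncard_brandtSet_mul_right hT hm hTT hidx n c.rep_mem c'.rep_mem)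

end Bijection

/-! ## §3 `W_{q⁻}` and `W_{p⁺}` commute with every Brandt matrix -/

/-- **`T(n)_{W_{q⁻} c, W_{q⁻} c'} = T(n)_{c c'}` for every `n`**, every Brandt setup and every `q ∣ N⁻`. [cite: VignerasLNM800, Ch. III §5 exercice 5.8 (d)] [cite: Voight2021, (41.3.5)] -/
theorem XiSetup.matrix_apply_wMinus_wMinus {q : ℕ} [hqf : Fact q.Prime] (hq : q ∣ Nminus) (n : ℕ) (c c' : ClassSet S.O) :
    matrix S.O n (S.wMinus q hq c) (S.wMinus q hq c') = matrix S.O n c c' :=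
  S.matrix_apply_mk_rep_mul (fun _ hI => S.mul_normPrimeIdeal_mem_of_dvd hq hI) hqf.out.ne_zero
    (fun _ hI => S.mul_normPrimeIdeal_mul_normPrimeIdeal_of_dvd hq hI)
    (fun _ hI _ hJ hJI => S.relIndex_mul_normPrimeIdeal_eq_relIndex hq hI hJ hJI) n c c'

/-- **`T(n)_{W_{p⁺} c, W_{p⁺} c'} = T(n)_{c c'}` for every `n`**, every Brandt setup and every prime `p ∤ N⁻`. [cite: BertoliniDarmon1996, §1.5] [cite: Voight2021, (41.3.5)] -/
theorem XiSetup.matrix_apply_wPlus_wPlus {p : ℕ} [hpf : Fact p.Prime] (hp : ¬ p ∣ Nminus) (n : ℕ) (c c' : ClassSet S.O) :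
    matrix S.O n (S.wPlus p hp c) (S.wPlus p hp c') = matrix S.O n c c' :=
  S.matrix_apply_mk_rep_mul (fun _ hI => S.mul_atkinLehnerIdeal_mem hp hI) (pow_ne_zero _ hpf.out.ne_zero)
    (fun _ hI => S.mul_atkinLehnerIdeal_mul_atkinLehnerIdeal hp hI)
    (fun _ hI _ hJ hJI => S.relIndex_mul_atkinLehnerIdeal_eq_relIndex hp hI hJ hJI) n c c'

/-- `T(n)_{c, W_{q⁻} c'} = T(n)_{W_{q⁻} c, c'}`. [cite: VignerasLNM800, Ch. III §5 exercice 5.8 (d)] -/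
theorem XiSetup.matrix_apply_wMinus_right {q : ℕ} [Fact q.Prime] (hq : q ∣ Nminus) (n : ℕ) (c c' : ClassSet S.O) :
    matrix S.O n c (S.wMinus q hq c') = matrix S.O n (S.wMinus q hq c) c' := by
  conv_lhs => rw [← S.wMinus_wMinus hq c]
  rw [S.matrix_apply_wMinus_wMinus]

/-- `T(n)_{c, W_{p⁺} c'} = T(n)_{W_{p⁺} c, c'}`. [cite: BertoliniDarmon1996, §1.5] -/
theorem XiSetup.matrix_apply_wPlus_right {p : ℕ} [Fact p.Prime] (hp : ¬ p ∣ Nminus) (n : ℕ) (c c' : ClassSet S.O) :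
    matrix S.O n c (S.wPlus p hp c') = matrix S.O n (S.wPlus p hp c) c' := by
  conv_lhs => rw [← S.wPlus_wPlus hp c]
  rw [S.matrix_apply_wPlus_wPlus]

/-- The diagonal Brandt entries are `W_{q⁻}`-invariant. [cite: VignerasLNM800, Ch. III §5 exercice 5.8 (d)] -/
theorem XiSetup.matrix_diag_wMinus {q : ℕ} [Fact q.Prime] (hq : q ∣ Nminus) (n : ℕ) (c : ClassSet S.O) :
    matrix S.O n (S.wMinus q hq c) (S.wMinus q hq c) = matrix S.O n c c :=
  S.matrix_apply_wMinus_wMinus hq n c c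

/-- The diagonal Brandt entries are `W_{p⁺}`-invariant. [cite: BertoliniDarmon1996, §1.5] -/
theorem XiSetup.matrix_diag_wPlus {p : ℕ} [Fact p.Prime] (hp : ¬ p ∣ Nminus) (n : ℕ) (c : ClassSet S.O) :
    matrix S.O n (S.wPlus p hp c) (S.wPlus p hp c) = matrix S.O n c c :=
  S.matrix_apply_wPlus_wPlus hp n c c

section MulVec

variable [Fintype (ClassSet S.O)]

/-- Reindexing a Hecke sum along an involution `W` with `T(n)_{W c, W d} = T(n)_{c d}`. [cite: VignerasLNM800, Ch. III §5 exercice 5.8 (d)] -/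
private theorem mulVec_comp_of_involutive {W : ClassSet S.O → ClassSet S.O} (hW : Function.Involutive W) (n : ℕ)
    (hTW : ∀ c d, matrix S.O n (W c) (W d) = matrix S.O n c d) (v : ClassSet S.O → ℤ) :
    matrix S.O n *ᵥ (v ∘ W) = (matrix S.O n *ᵥ v) ∘ W := by
  funext c
  simp only [Matrix.mulVec, dotProduct, Function.comp_apply]
  have h1 : ∑ d, matrix S.O n (W c) (W d) * v (W d) = ∑ d, matrix S.O n (W c) d * v d :=
    Fintype.sum_bijective W hW.bijective (fun d => matrix S.O n (W c) (W d) * v (W d))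
      (fun d => matrix S.O n (W c) d * v d) fun _ => rfl
  rw [← h1]
  exact Finset.sum_congr rfl fun d _ => by rw [hTW]

/-- **The Hecke action on `ℤ^{Cls O}` commutes with `W_{q⁻}`**: `T(n) (v ∘ W) = (T(n) v) ∘ W` for every `n`. [cite: VignerasLNM800, Ch. III §5 exercice 5.8 (d)] [cite: BertoliniDarmon1996, §1.5] -/
theorem XiSetup.mulVec_comp_wMinus {q : ℕ} [Fact q.Prime] (hq : q ∣ Nminus) (n : ℕ) (v : ClassSet S.O → ℤ) :
    matrix S.O n *ᵥ (v ∘ S.wMinus q hq) = (matrix S.O n *ᵥ v) ∘ S.wMinus q hq :=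
  mulVec_comp_of_involutive S (S.involutive_wMinus hq) n (fun c d => S.matrix_apply_wMinus_wMinus hq n c d) v

/-- **The Hecke action on `ℤ^{Cls O}` commutes with `W_{p⁺}`**: `T(n) (v ∘ W) = (T(n) v) ∘ W` for every `n`. [cite: BertoliniDarmon1996, §1.5] [cite: Voight2021, (41.3.5)] -/
theorem XiSetup.mulVec_comp_wPlus {p : ℕ} [Fact p.Prime] (hp : ¬ p ∣ Nminus) (n : ℕ) (v : ClassSet S.O → ℤ) :
    matrix S.O n *ᵥ (v ∘ S.wPlus p hp) = (matrix S.O n *ᵥ v) ∘ S.wPlus p hp :=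
  mulVec_comp_of_involutive S (S.involutive_wPlus hp) n (fun c d => S.matrix_apply_wPlus_wPlus hp n c d) v

/-! ## §4 `T(n) T(q) = T(q) T(n)` for every `n` at a ramified prime `q` -/

/-- **`(T(n) T(q))_{c c'} = T(n)_{c, W_{q⁻} c'}`** (`T(q)` is the permutation matrix of `W_{q⁻}`). [cite: VignerasLNM800, Ch. III §5 exercice 5.8 (b)] -/
theorem XiSetup.matrix_mul_matrix_ramified_apply_of_dvd {q : ℕ} [Fact q.Prime] (hq : q ∣ Nminus) (n : ℕ)
    (c c' : ClassSet S.O) : (matrix S.O n * matrix S.O q) c c' = matrix S.O n c (S.wMinus q hq c') := by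
  classical
  rw [Matrix.mul_apply]
  simp only [S.matrix_ramified_apply_of_dvd hq, mul_ite, mul_one, mul_zero, Finset.sum_ite_eq', Finset.mem_univ,
    if_true]

/-- **`(T(q) T(n))_{c c'} = T(n)_{W_{q⁻} c, c'}`.** [cite: VignerasLNM800, Ch. III §5 exercice 5.8 (b)–(c)] -/
theorem XiSetup.matrix_ramified_mul_matrix_apply_of_dvd {q : ℕ} [Fact q.Prime] (hq : q ∣ Nminus) (n : ℕ)
    (c c' : ClassSet S.O) : (matrix S.O q * matrix S.O n) c c' = matrix S.O n (S.wMinus q hq c) c' := by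
  classical
  rw [Matrix.mul_apply]
  have h : ∀ d : ClassSet S.O, matrix S.O q c d = matrix S.O q d c := fun d => S.matrix_ramified_symm_of_dvd hq c d
  simp only [h, S.matrix_ramified_apply_of_dvd hq, ite_mul, one_mul, zero_mul, Finset.sum_ite_eq', Finset.mem_univ,
    if_true]

/-- **`T(n) T(q) = T(q) T(n)` for EVERY `n`, every Brandt setup and every ramified prime `q ∣ N⁻`** (Vignéras III §5
ex. 5.8 (d); the tree's `XiSetup.matrix_comm_of_coprime_level` covers `n` prime to `N⁺` only). [cite: VignerasLNM800, Ch. III §5 exercice 5.8 (d)] [cite: Voight2021, (41.3.5)] -/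
theorem XiSetup.matrix_mul_matrix_ramified_comm_of_dvd {q : ℕ} [Fact q.Prime] (hq : q ∣ Nminus) (n : ℕ) :
    matrix S.O n * matrix S.O q = matrix S.O q * matrix S.O n := by
  ext c c'
  rw [S.matrix_mul_matrix_ramified_apply_of_dvd hq, S.matrix_ramified_mul_matrix_apply_of_dvd hq,
    S.matrix_apply_wMinus_right]

end MulVec

end Brandt

end Literature.NumberTheory.Automorphic

end
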